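import Summits.MatrixMultiplication.MatrixMultiplication.Theorems.AbelianSTPPCensusTAStatData

/-!
# T_A certificate past 1700: the static t*-indexed linear checker (definitions)

Cell mm-stpp (rung F-M1), threshold T_A = `τ = 2.371`.  The landed one-pass certificate (`TALin1200/1700`, kernel range `≤ 1700`) bounds the
non-maximal members of a shape list by ONE Grynkiewicz budget taken at `t = t_l` = (smallest size)·(middle size) of the MAXIMAL-VOLUME member `l`,
and first fails at order `1728` on thin maximal members.  This checker indexes the budget by `t* := max_i t_i` over ALL members — the member
attaining `t*` supplies a Grynkiewicz budget at every parameter `t′ ∈ (its smallest size, t*]` (`TAStatSound.budget_form'`) — and restricts both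
densities (vM `g/p`, U11-G `g/(t′·p − V)`) to shapes with `t ≤ t*` and `V ≤ V_l`.  Both restrictions are discretised: volumes into `levels`
(`VL`, a level covers the volumes `≤ VL[i]`) and `t*` into `buckets` (`TB`, bucket `j` = `[TB[j], TB[j+1] − 1]`, budget parameter `t′ = TB[j]`);
the densities are a STATIC table `TAStatData.E[i][j]` (no state threaded through the kernel evaluation), certified by domination checks
(`domV`: every sorted candidate shape is dominated by the entry of its own level and bucket; `monoOK`: the table is monotone).  The order `M` is not
enumerated: every bound is affine in `M` and subtraction-free, so endpoint evaluations cover intervals of orders (`cover`: the U11-G bound from a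
verified threshold `M₁` on; below it the vM bound through one of three caps on the companions' `Σ p` — U11 `2Σp + d ≤ 3M`, U14 `Σp + 3V ≤ 3M`,
E3 `Σp + 4V ≤ ⌊V²/M⌋ + 3M` for `M < 2V` — on one or `J` sub-intervals).  Hypotheses on the shape list: `SieveAdmissible M`, `U11G M`,
`TAKnap575.E3Adm M` — the union of the hypotheses of the landed T_A certificates.  Universe `Mtop = 5000`, orders `lo = 1701 … 5000`, gains
`ShapeCert.gainOf2371h` (table to `V ≤ 5700`).  Exact integer twin: HOME/mm-stpp-theory/tastat/tastat.py (kit j278655: all 1 354 011 (shape, bucket) checks pass at this universe).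
WHAT THIS IS NOT: no statement about STPP families or `ω` — arithmetic on shape lists only; nothing about orders `> 5000`.
-/

set_option linter.dupNamespace false
set_option autoImplicit false

namespace Summit.MatrixMultiplication.MatrixMultiplication.Theorems.TAStat

open TECert (tableOK vol us)
open ShapeCert (gainOf2371h D)
open TAStatData (E VL TB)

/-! ## Parameters -/

/-- Largest order of the certificate (= the order of the single-member table defining the candidate shapes). -/
def Mtop : ℕ := 5000
/-- Least order of the certificate (orders `≤ 1700`: `noAbelianSTPPHostUpTo_2371_1700`). -/
def lo : ℕ := 1701
/-- Number of sub-intervals of orders on which the vM bound is re-checked by endpoint evaluation when one interval does not suffice. -/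
def J : ℕ := 12

/-! ## Candidate shapes (sorted), levels and buckets -/

/-- The sorted candidate shapes `(a, b, c)`, `a ≤ b ≤ c`, of volume exactly `V`, passing `TECert.tableOK` at order `Mtop`
(`a ≤ 17`, `b ≤ 75` suffice since `18³ > Mtop` and `76² > Mtop`). -/
def triplesS (V : ℕ) : List (ℕ × ℕ × ℕ) :=
  (List.range 17).flatMap fun a' =>
    if V % (a' + 1) = 0 then
      (List.range 75).filterMap fun b' =>
        if a' ≤ b' ∧ V / (a' + 1) % (b' + 1) = 0 ∧ b' + 1 ≤ V / (a' + 1) / (b' + 1) ∧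
            tableOK Mtop (a' + 1) (b' + 1) (V / (a' + 1) / (b' + 1)) = true then
          some (a' + 1, b' + 1, V / (a' + 1) / (b' + 1))
        else none
    else []

/-- `t` of a shape: the least of the three pair products (= the product of the two smaller sizes; symmetric). -/
def tm (x : ℕ × ℕ × ℕ) : ℕ := min (min (x.1 * x.2.1) (x.2.1 * x.2.2)) (x.2.2 * x.1)

/-- level of a volume: the first index `i` with `V ≤ VL[i]` (`VL.length` if none). -/
def levOf (V : ℕ) : ℕ := VL.findIdx fun vl => decide (V ≤ vl)

/-- bucket of a parameter `t ≥ 1`: the last index `j` with `TB[j] ≤ t` (computed as (first index with `t < TB[j]`) − 1). -/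
def bucketOf (t : ℕ) : ℕ := (TB.findIdx fun b => decide (t < b)) - 1

/-- lower end `TB[j]` of bucket `j` (default `0`) -/
def tb (j : ℕ) : ℕ := TB.getD j 0

/-! ## The table entries -/

/-- A density entry `(gP, pP, gW, wW)`: `gP/pP` bounds `g(V′)/p` and `gW/wW` bounds `g(V′)/(TB[j]·p − V′)` over the sorted candidate shapes of
the entry's level `i` (volume `≤ VL[i]`) and bucket `j` (`tm ≤ TB[j+1] − 1`). -/
abbrev Entry : Type := ℕ × ℕ × ℕ × ℕ

/-- the empty entry -/
def e0 : Entry := (0, 1, 0, 1)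

/-- entry `(i, j)` of the table -/
def ent (i j : ℕ) : Entry := (E.getD i []).getD j e0

/-- vM domination of a shape (gain `g`, pair-product sum `p`) by an entry: `g·pP ≤ gP·p`. -/
def domP (g p : ℕ) (e : Entry) : Bool := Nat.ble (g * e.2.1) (e.1 * p)

/-- U11-G domination of a shape (gain `g`, volume `V`, pair-product sum `p`) along a table row from bucket `j` on, each entry read at its own bucket
lower end `t = TB[j]`: `V < t·p` and `g·wW ≤ gW·(t·p − V)`. -/
def domWrow (g V p : ℕ) : List Entry → ℕ → Bool
  | [], _ => true
  | e :: es, j => Nat.blt V (tb j * p) && Nat.ble (g * e.2.2.2) (e.2.2.1 * (tb j * p - V)) && domWrow g V p es (j + 1)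

/-- domination of one sorted candidate shape `x` of volume `V` (gain `g`): vM at its own (level, bucket), U11-G at its own level and every bucket
from its own on. -/
def domX (V g : ℕ) (x : ℕ × ℕ × ℕ) : Bool :=
  domP g (us x) ((E.getD (levOf V) []).getD (bucketOf (tm x)) e0) &&
    domWrow g V (us x) ((E.getD (levOf V) []).drop (bucketOf (tm x))) (bucketOf (tm x))

/-- every sorted candidate shape of the volumes `V, …, V + n − 1` is dominated (`domX`) -/
def domV : ℕ → ℕ → Bool
  | 0, _ => true
  | n + 1, V => (triplesS V).all (domX V (gainOf2371h V)) && domV n (V + 1)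

/-- entry `e′` dominates entry `e` in the vM fraction: `gP/pP ≤ gP′/pP′` -/
def leP (e e' : Entry) : Bool := Nat.ble (e.1 * e'.2.1) (e'.1 * e.2.1)
/-- entry `e′` dominates entry `e` in the U11-G fraction (same bucket): `gW/wW ≤ gW′/wW′` -/
def leW (e e' : Entry) : Bool := Nat.ble (e.2.2.1 * e'.2.2.2) (e'.2.2.1 * e.2.2.2)

/-- Structural facts about the data, all checked by evaluation: every row has `nb` entries; all denominators are positive; the vM fraction is
monotone in the level and in the bucket, the U11-G fraction is monotone in the level; `TB[0] = 1`, `TB` is increasing with `TB[j+1] ≤ 2·TB[j]`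
and (`TB[j] ≤ 1` or `TB[j+1] ≤ TB[j]²`). -/
def monoOK (nl nb : ℕ) : Bool :=
  Nat.beq (tb 0) 1 &&
  (List.range nl).all (fun i => Nat.beq (E.getD i []).length nb &&
    (List.range nb).all (fun j =>
      Nat.ble 1 (ent i j).2.1 && Nat.ble 1 (ent i j).2.2.2 &&
      (Nat.ble (nl - 1) i || (leP (ent i j) (ent (i + 1) j) && leW (ent i j) (ent (i + 1) j))) &&
      (Nat.ble (nb - 1) j || leP (ent i j) (ent i (j + 1))))) &&
  (List.range nb).all (fun j => Nat.blt (tb j) (tb (j + 1)) && Nat.ble (tb (j + 1)) (2 * tb j) &&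
    (Nat.ble (tb j) 1 || Nat.ble (tb (j + 1)) (tb j * tb j)))

/-! ## The checks (all comparisons affine in the order `M`, subtraction-free) -/

/-- U11-G bound at order `M` for a maximal member (gain `g`, pair-product sum `p`, volume `V`) at budget parameter `t`:
`t·gW·M + (g·wW + (2t²−1)·gW) ≤ 10⁶·wW·M + (t·p − V)·gW`. -/
def vpI (g p V t M : ℕ) (e : Entry) : Bool :=
  Nat.ble (t * e.2.2.1 * M + (g * e.2.2.2 + (2 * t * t - 1) * e.2.2.1)) (D * e.2.2.2 * M + (t * p - V) * e.2.2.1)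

/-- vM bound through the U11 cap `2·Σ p + d ≤ 3M` (`d = 2p − (a+b+c)`): `2g·pP + 3M·gP ≤ 2·10⁶·M·pP + d·gP`. -/
def p1I (g d M : ℕ) (e : Entry) : Bool := Nat.ble (2 * g * e.2.1 + 3 * M * e.1) (2 * D * M * e.2.1 + d * e.1)

/-- vM bound through the U14 cap `Σ p + 3V ≤ 3M`: `g·pP + 3M·gP ≤ 10⁶·M·pP + 3V·gP`. -/
def p2I (g V M : ℕ) (e : Entry) : Bool := Nat.ble (g * e.2.1 + 3 * M * e.1) (D * M * e.2.1 + 3 * V * e.1)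

/-- vM bound through the E3 cap `Σ p + 4V ≤ ⌊V²/M⌋ + 3M` (order `M < 2V`), multiplied through by `M` (no division):
`g·pP·M + 3M²·gP + V²·gP ≤ 10⁶·M²·pP + 4V·M·gP` — as a function of `M` this is «quadratic ≥ 0», and two endpoint evaluations cover the interval
between them (`TAStatSound.quad_between`). -/
def p3I (g V M : ℕ) (e : Entry) : Bool :=
  Nat.ble (g * e.2.1 * M + 3 * M * M * e.1 + V * V * e.1) (D * M * M * e.2.1 + 4 * V * M * e.1)

/-- One interval of orders `[m, m₂]` is covered by ONE cap, checked at both endpoints (E3 only if `m₂ < 2V`). -/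
def piece (g V d : ℕ) (e : Entry) (m m₂ : ℕ) : Bool :=
  (p1I g d m e && p1I g d m₂ e) || (p2I g V m e && p2I g V m₂ e) || (Nat.blt m₂ (2 * V) && p3I g V m e && p3I g V m₂ e)

/-- The orders `[lo′, hi′]` are covered by at most `k` consecutive pieces (fuel `k`; empty ranges pass). -/
def pcs (g V d : ℕ) (e : Entry) : ℕ → ℕ → ℕ → Bool
  | 0, lo', hi' => Nat.blt hi' lo'
  | k + 1, lo', hi' => Nat.blt hi' lo' ||
      (piece g V d e lo' (lo' + (hi' - lo') / (k + 1)) && pcs g V d e k (lo' + (hi' - lo') / (k + 1) + 1) hi')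

/-- Candidate U11-G threshold (a division estimate; only its verification below matters): the least order `M ≥ L` suggested by the affine inequality
`vpI` and by `t·p − V ≤ t·M`. -/
def vpCand (g p V t L H : ℕ) (e : Entry) : ℕ :=
  max L (max ((t * p - V + t - 1) / t)
    (if g * e.2.2.2 + (2 * t * t - 1) * e.2.2.1 ≤ (t * p - V) * e.2.2.1 then 0
     else if D * e.2.2.2 - t * e.2.2.1 = 0 then H + 1
     else (g * e.2.2.2 + (2 * t * t - 1) * e.2.2.1 - (t * p - V) * e.2.2.1 + (D * e.2.2.2 - t * e.2.2.1) - 1) / (D * e.2.2.2 - t * e.2.2.1)))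

/-- The verified U11-G threshold: an order `M₁ ∈ [L, H]` with `3 ≤ t`, `t·gW ≤ 10⁶·wW`, `vpI` at `M₁` and `t·p − V ≤ t·M₁` (the U11-G bound then holds at
every order `≥ M₁`, `TAStatSound.vp_mono`), or `H + 1` if the candidate does not verify. -/
def vpThresh (g p V t L H : ℕ) (e : Entry) : ℕ :=
  let c := vpCand g p V t L H e
  if 3 ≤ t ∧ V < t * p ∧ t * e.2.2.1 ≤ D * e.2.2.2 ∧ c ≤ H ∧ vpI g p V t c e = true ∧ t * p - V ≤ t * c then c else H + 1

/-- The check of a maximal member (gain `g`, pair-product sum `p`, volume `V`, excess `d`) at budget parameter `t` for the orders `[L, H]`: U11-G from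
the threshold on, vM (one piece, else `J` pieces) below it. -/
def cover (g p V d t L H : ℕ) (e : Entry) : Bool :=
  let M1 := vpThresh g p V t L H e
  Nat.ble M1 L || (piece g V d e L (min H (M1 - 1)) || pcs g V d e J L (min H (M1 - 1)))

/-- Walk the buckets `j, j+1, …` of a table row (the row dropped to index `j`) while `TB[j]³ ≤ V²`, checking `cover` at `t = TB[j]`. -/
def walk (g p V d L H : ℕ) : List Entry → ℕ → Bool
  | [], _ => true
  | e :: es, j => Nat.blt (V * V) (tb j * tb j * tb j) || (cover g p V d (tb j) L H e && walk g p V d L H es (j + 1))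

/-- The check of one sorted candidate shape `x` of volume `V` (gain `g`) as the maximal-volume member, for all orders `max(lo, V+1) … Mtop` and all
buckets from that of `x.1·x.2.1` on. -/
def checkShape (V g : ℕ) (x : ℕ × ℕ × ℕ) : Bool :=
  Nat.blt Mtop (max lo (V + 1)) ||
    walk g (us x) V (2 * us x - (x.1 + x.2.1 + x.2.2)) (max lo (V + 1)) Mtop
      ((E.getD (levOf V) []).drop (bucketOf (x.1 * x.2.1))) (bucketOf (x.1 * x.2.1))

/-- every sorted candidate shape of the volumes `V, …, V + n − 1` passes `checkShape` -/
def checkV : ℕ → ℕ → Bool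
  | 0, _ => true
  | n + 1, V => (triplesS V).all (checkShape V (gainOf2371h V)) && checkV n (V + 1)

/-! ## Specification vocabulary of the soundness proof (checker-internal predicates, no claims) -/

/-- Sorted candidate shapes: `1 ≤ a ≤ b ≤ c` and the single-member table at order `Mtop`. [bookkeeping] -/
def SCand (x : ℕ × ℕ × ℕ) : Prop :=
  1 ≤ x.1 ∧ x.1 ≤ x.2.1 ∧ x.2.1 ≤ x.2.2 ∧ tableOK Mtop x.1 x.2.1 x.2.2 = true

end Summit.MatrixMultiplication.MatrixMultiplication.Theorems.TAStat
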